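import Literature.AlgebraicGeometry.HodgeTheory.DworkSexticPencilChart
import Literature.AlgebraicGeometry.HodgeTheory.DworkSexticPencilHodgeLoci
import Literature.AlgebraicGeometry.HodgeTheory.HyperplaneSectionMonodromyProofs
import Literature.AlgebraicGeometry.HodgeTheory.SpecialisationMapComplexPoints
import Literature.AlgebraicGeometry.HodgeTheory.VanishingCycleOfNode
import Mathlib.Analysis.Analytic.IsolatedZeros
import Mathlib.Analysis.Convex.Topology
import HarnessLib

/-!
# Griffiths' holomorphic Hodge frames along the Dwork pencil (Voisin I Thm. 10.3, named fact) and the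
# dichotomy of the locus `{ξ|_{𝒳_s} ∈ F²}` on the curve `D(ℂ)` (proved from it)

Family `hodge`, layer `Literature/AlgebraicGeometry/HodgeTheory` (namespace `DworkSextic`). ONE named fact
(`Griffiths1968_dworkPencil_holomorphicHodgeFrames`, Voisin I Thm. 10.3 / Griffiths 1968 in frame form along
the Dwork pencil) and ONE DISCHARGE: the named fact
`DworkSextic.Voisin2002_dworkPencil_hodgeFiltrationTwo_locus_dichotomy` of `DworkSexticPencilHodgeLoci` (one of
the two analytic inputs of the crux `GenericInvariantHodgeClasses`, stmt-HodgeConjecture-24129, route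
`HodgeConjecture/DworkReflectionQuotients`) FOLLOWS from the frames by the identity theorem in one variable
(`Voisin2002_dworkPencil_hodgeFiltrationTwo_locus_dichotomy_of_holomorphicHodgeFrames`). Net debt `+1 − 0`
here, but the derived fact `…_locus_dichotomy` is thereby reduced to the primary, print-verbatim one.

Carriers: the pencil `π = DworkSextic.pencil : 𝒳 → D` (`DworkSexticPencilFamily`), its chart
`ψ = DworkSextic.pencilParam : D(ℂ) → ℂ` (an open embedding onto `ℂ ∖ μ₆`, `DworkSexticPencilChart`), tube
classes `H⁴(π⁻¹B(ℂ); ℂ)` (`tubeOver`), `fiberRestrict`, `IsInHodgeFiltration`, Mathlib `Module.Basis` and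
`AnalyticOnNhd`.

Sources, verbatim. C. Voisin, *Hodge Theory and Complex Algebraic Geometry I* (2002), §9.2.1 ("`Rᵏπ_*A` is a
local system … trivialised over a ball `B`"), §10.2.1 Thm. 10.3: "the `F^pH^k(X_b) ⊂ H^k(X_b, ℂ)`, `b ∈ B`,
are the fibres of a holomorphic subbundle `F^p𝓗^k ⊂ 𝓗^k`". *II* (2003), §5.3.1 Lemma 5.13: "the sets
`U_λ^p` are analytic subsets of `U`".

## References

* [VoisinHodgeI2002] C. Voisin, Hodge Theory and Complex Algebraic Geometry I (2002), §9.2.1, Thm. 10.3.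
* [VoisinHodgeII2003] C. Voisin, Hodge Theory and Complex Algebraic Geometry II (2003), §5.3.1 Lemma 5.13.
* [Griffiths1968PeriodsII] P. Griffiths, Periods of integrals on algebraic manifolds II, Amer. J. Math. 90
  (1968), Thm. 1.1 (holomorphy of the Hodge filtration bundles).
-/

noncomputable section

open _root_.Topology _root_.Filter
open scoped BigOperators

namespace Literature.AlgebraicGeometry.HodgeTheory.DworkSextic

open Literature.AlgebraicGeometry.Motives Literature.AlgebraicGeometry.Motives.UniversalHypersurface
open Literature.AlgebraicGeometry.HodgeTheory.UniversalHypersurface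
open Literature.AlgebraicTopology.SingularHomology

/-! ### §1 Griffiths' holomorphic frames adapted to the Hodge filtration, along the pencil -/

/-- **Griffiths' theorem: the Hodge bundles `F^r𝓗⁴` of the Dwork pencil are holomorphic subbundles of the
flat bundle `𝓗⁴`** (Voisin, *Hodge Theory I*, Thm. 10.3: "the `F^pH^k(X_b) ⊂ H^k(X_b, ℂ)`, `b ∈ B`, are
the fibres of a holomorphic subbundle `F^p𝓗^k ⊂ 𝓗^k`"; Griffiths 1968), in FRAME FORM over a flat
trivialisation (the form used by the tree's `HodgeLociDichotomyOfHolomorphicFrames` for the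
Baldi–Klingler–Ullmo dichotomy). For the pencil `π : 𝒳 → D = 𝔸¹ ∖ μ₆` (`DworkSextic.pencil`) and every
`t₀ ∈ D(ℂ)`: there is an open `B ∋ t₀` over which restriction `H⁴(π⁻¹B(ℂ); ℂ) → H⁴(𝒳_s(ℂ); ℂ)` is bijective
for every `s ∈ B` (an Ehresmann ball: the fixed space `V = H⁴(π⁻¹B(ℂ); ℂ)` IS the flat trivialisation of
`𝓗⁴|_B`, Voisin I §9.2.1), a moving basis `e(s) = (e_σ(s))_σ` of `V`, `s ∈ B`, graded by `deg`, ADAPTED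
to the Hodge filtration — `F^rH⁴(𝒳_s) = span{e_σ(s)|_{𝒳_s} : deg σ ≥ r}` for all `r` — and HOLOMORPHIC in
the parameter `ψ` of the pencil: the coordinates `e(s)^*_σ(w)` of every fixed `w ∈ V` are holomorphic
functions of `ψ(s)` (`DworkSextic.pencilParam`, the chart `D(ℂ) ≅ ℂ ∖ μ₆` of `DworkSexticPencilChart`)
on `ψ(B)`. (A holomorphic frame of `𝓗⁴` adapted to the flag of holomorphic subbundles
`F⁴ ⊂ F³ ⊂ F² ⊂ F¹ ⊂ F⁰ = 𝓗⁴` exists locally; in the flat frame its matrix is holomorphic and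
invertible, so the dual coordinates are holomorphic.)
`-- TODO(general form): Voisin I Thm. 10.3 for an arbitrary smooth projective family over a complex manifold.`
[cite: VoisinHodgeI2002, §10.2.1 Thm. 10.3 and §9.2.1] [cite: Griffiths1968PeriodsII, Thm. 1.1] -/
def Griffiths1968_dworkPencil_holomorphicHodgeFrames : Prop :=
  ∀ t₀ : ComplexPoints (baseSpz ℂ 4 6 pencilSpz),
    ∃ B : Set (ComplexPoints (baseSpz ℂ 4 6 pencilSpz)), IsOpen B ∧ t₀ ∈ B ∧
      (∀ (s : ComplexPoints (baseSpz ℂ 4 6 pencilSpz)) (hs : s ∈ B),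
        Function.Bijective (fiberRestrict pencil hs (2 * 2))) ∧
      ∃ (N : ℕ) (deg : Fin N → ℕ)
        (e : B → Module.Basis (Fin N) ℂ (singularCohomology ℂ ℂ (tubeOver pencil B) (2 * 2))),
        (∀ (s : B) (r : ℕ) (x : complexBetti (fiberOver pencil s.1) (2 * 2)),
          IsInHodgeFiltration 4 (fiberOver pencil s.1) (2 * 2) r x ↔
            x ∈ Submodule.span ℂ (Set.range fun σ : {σ : Fin N // r ≤ deg σ} =>
              fiberRestrict pencil s.2 (2 * 2) (e s σ.1))) ∧
        (∀ (w : singularCohomology ℂ ℂ (tubeOver pencil B) (2 * 2)) (σ : Fin N),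
          ∃ g : ℂ → ℂ, AnalyticOnNhd ℂ g (pencilParam '' B) ∧
            ∀ s : B, (e s).repr w σ = g (pencilParam s.1))

/-! ### §2 The dichotomy of the locus `{ξ|_{𝒳_s} ∈ F²}` from the holomorphic frames -/

/-- Restricting a tube class to a smaller tube and then to a fibre is restriction to the fibre. [folklore] -/
private theorem fiberRestrict_map_tubeOverInclusion {U U' : Set (ComplexPoints (baseSpz ℂ 4 6 pencilSpz))}
    (h : U ⊆ U') {t : ComplexPoints (baseSpz ℂ 4 6 pencilSpz)} (ht : t ∈ U) (k : ℕ)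
    (ξ : singularCohomology ℂ ℂ (tubeOver pencil U') k) :
    fiberRestrict pencil ht k (singularCohomology.map ℂ ℂ (tubeOverInclusion pencil h) k ξ) =
      fiberRestrict pencil (h ht) k ξ := by
  rw [fiberRestrict, fiberRestrict, ← ModuleCat.comp_apply, ← singularCohomology.map_comp,
    tubeOverInclusion_comp_fiberToTube]

/-- Coordinates of a combination of basis vectors of degree `≥ r` vanish in degree `< r`. [folklore] -/
private theorem repr_sum_smul_eq_zero {N : ℕ} {V : Type*} [AddCommGroup V] [Module ℂ V]
    (e : Module.Basis (Fin N) ℂ V) (deg : Fin N → ℕ) (r : ℕ) (d : {σ : Fin N // r ≤ deg σ} → ℂ)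
    {σ : Fin N} (hσ : deg σ < r) :
    e.repr (∑ τ : {τ : Fin N // r ≤ deg τ}, d τ • e τ.1) σ = 0 := by
  rw [map_sum, Finsupp.finsetSum_apply]
  refine Finset.sum_eq_zero fun τ _ => ?_
  rw [map_smul, Module.Basis.repr_self, Finsupp.smul_apply, Finsupp.single_apply,
    if_neg (fun h : τ.1 = σ => absurd (h ▸ τ.2) (not_le.mpr hσ)), smul_zero]

/-- **The holomorphic frames imply the dichotomy `Voisin2002_dworkPencil_hodgeFiltrationTwo_locus_dichotomy`**
(Voisin I Thm. 10.3 ⟹ Voisin II Lemma 5.13 on the curve `D(ℂ)`): in a holomorphic frame adapted to `F²`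
over an Ehresmann ball, the locus `{s : ξ|_{𝒳_s} ∈ F²}` of a flat section is the common zero set of the
coordinates of degree `< 2` of a fixed vector, holomorphic functions of `ψ(s)`; if it accumulates at `t`,
the identity theorem on a disc around `ψ(t)` (`AnalyticOnNhd.eqOn_zero_of_preconnected_of_frequently_eq_zero`)
makes them vanish near `ψ(t)`, so the locus is a neighbourhood of `t`.
[cite: VoisinHodgeI2002, Thm. 10.3] [cite: VoisinHodgeII2003, §5.3.1 Lemma 5.13] -/
theorem Voisin2002_dworkPencil_hodgeFiltrationTwo_locus_dichotomy_of_holomorphicHodgeFrames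
    (hF : Griffiths1968_dworkPencil_holomorphicHodgeFrames) :
    Voisin2002_dworkPencil_hodgeFiltrationTwo_locus_dichotomy := by
  classical
  intro B' hB'o ξ t htB' hfreq
  -- the frame around `t`
  obtain ⟨B, hBo, htB, hbij, N, deg, e, hspan, hhol⟩ := hF t
  -- an Ehresmann ball `B'' ⊆ B ∩ B'` around `t`
  obtain ⟨B'', hB''o, htB'', hB''W, -, hB''e⟩ :=
    isHomotopicallyLocallyTrivialOn_pencil.exists_nhds_homotopyEquiv (Set.mem_univ t) (B ∩ B')
      ((hBo.inter hB'o).mem_nhds ⟨htB, htB'⟩)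
  have hB''B : B'' ⊆ B := fun s hs => (hB''W hs).1
  have hB''B' : B'' ⊆ B' := fun s hs => (hB''W hs).2
  have hSp : IsSpecialisingNhd pencil t (2 * 2) B'' := by
    obtain ⟨f, hf⟩ := hB''e htB''
    exact IsSpecialisingNhd.of_homotopyEquiv hB''o htB'' f hf (2 * 2)
  -- the flat vector `w ∈ V = H⁴(π⁻¹B)` with `w|_t = ξ|_t`
  obtain ⟨w, hw⟩ := (hbij t htB).2 (fiberRestrict pencil htB' (2 * 2) ξ)
  -- `w` and `ξ` agree on every fibre over `B''`
  have hagree : ∀ (s : ComplexPoints (baseSpz ℂ 4 6 pencilSpz)) (hs : s ∈ B''),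
      fiberRestrict pencil (hB''B hs) (2 * 2) w = fiberRestrict pencil (hB''B' hs) (2 * 2) ξ := by
    intro s hs
    have heq : singularCohomology.map ℂ ℂ (tubeOverInclusion pencil hB''B) (2 * 2) w =
        singularCohomology.map ℂ ℂ (tubeOverInclusion pencil hB''B') (2 * 2) ξ := by
      apply hSp.bijective.1
      change fiberRestrict pencil htB'' (2 * 2) _ = fiberRestrict pencil htB'' (2 * 2) _
      rw [fiberRestrict_map_tubeOverInclusion, fiberRestrict_map_tubeOverInclusion]
      exact hw
    rw [← fiberRestrict_map_tubeOverInclusion hB''B hs, ← fiberRestrict_map_tubeOverInclusion hB''B' hs, heq]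
  -- membership in `F²` ⟺ the coordinates of `w` of degree `< 2` vanish
  have hcoord : ∀ (s : ComplexPoints (baseSpz ℂ 4 6 pencilSpz)) (hs : s ∈ B''),
      (IsInHodgeFiltration 4 (fiberOver pencil s) (2 * 2) 2 (fiberRestrict pencil (hB''B' hs) (2 * 2) ξ) ↔
        ∀ σ : Fin N, deg σ < 2 → (e ⟨s, hB''B hs⟩).repr w σ = 0) := by
    intro s hs
    rw [← hagree s hs, hspan ⟨s, hB''B hs⟩ 2]
    constructor
    · intro hmem σ hσ
      obtain ⟨d, hd⟩ := (Submodule.mem_span_range_iff_exists_fun ℂ).mp hmem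
      -- the combination `w' = Σ d_τ e_τ(s)` restricts like `w`, hence equals `w`
      set w' : singularCohomology ℂ ℂ (tubeOver pencil B) (2 * 2) :=
        ∑ τ : {τ : Fin N // 2 ≤ deg τ}, d τ • (e ⟨s, hB''B hs⟩) τ.1 with hw'
      have hres : fiberRestrict pencil (hB''B hs) (2 * 2) w' = fiberRestrict pencil (hB''B hs) (2 * 2) w := by
        rw [hw', map_sum, ← hd]
        exact Finset.sum_congr rfl fun τ _ => by rw [map_smul]
      have hww' : w' = w := (hbij s (hB''B hs)).1 hres
      rw [← hww', hw']
      exact repr_sum_smul_eq_zero _ deg 2 d hσ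
    · intro hzero
      -- `w = Σ_σ c_σ e_σ(s)` with `c_σ = 0` for `deg σ < 2`
      have hw_eq : w = ∑ σ : Fin N, (e ⟨s, hB''B hs⟩).repr w σ • (e ⟨s, hB''B hs⟩) σ :=
        ((e ⟨s, hB''B hs⟩).sum_repr w).symm
      rw [hw_eq, map_sum]
      refine Submodule.sum_mem _ fun σ _ => ?_
      rw [map_smul]
      by_cases hσ : 2 ≤ deg σ
      · exact Submodule.smul_mem _ _ (Submodule.subset_span ⟨⟨σ, hσ⟩, rfl⟩)
      · rw [hzero σ (not_le.mp hσ), zero_smul]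
        exact Submodule.zero_mem _
  -- the holomorphic coordinate functions
  choose g hg using hhol w
  -- accumulation at `t` read through the chart `ψ`
  have hfreq' : ∃ᶠ s in 𝓝[≠] t, s ∈ B'' ∧ ∀ σ : Fin N, deg σ < 2 → g σ (pencilParam s) = 0 := by
    have hev : ∀ᶠ s in 𝓝[≠] t, s ∈ B'' := mem_nhdsWithin_of_mem_nhds (hB''o.mem_nhds htB'')
    refine (hfreq.and_eventually hev).mono ?_
    rintro s ⟨⟨hs', hsF⟩, hsB''⟩
    refine ⟨hsB'', fun σ hσ => ?_⟩
    rw [← (hg σ).2 ⟨s, hB''B hsB''⟩]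
    exact (hcoord s hsB'').mp hsF σ hσ
  have hψ := isOpenEmbedding_pencilParam
  have hfreqC : ∃ᶠ z in 𝓝[≠] (pencilParam t),
      z ∈ pencilParam '' B'' ∧ ∀ σ : Fin N, deg σ < 2 → g σ z = 0 := by
    have h1 : ∃ᶠ z in Filter.map pencilParam (𝓝[≠] t),
        z ∈ pencilParam '' B'' ∧ ∀ σ : Fin N, deg σ < 2 → g σ z = 0 := by
      rw [Filter.frequently_map]
      exact hfreq'.mono fun s hs => ⟨⟨s, hs.1, rfl⟩, hs.2⟩
    rw [hψ.isEmbedding.map_nhdsWithin_eq] at h1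
    refine h1.filter_mono (nhdsWithin_mono _ ?_)
    rintro _ ⟨s, hs, rfl⟩
    exact fun h => hs (hψ.injective h)
  -- a disc around `ψ(t)` inside the open set `ψ(B'')`
  have hopen : IsOpen (pencilParam '' B'') := hψ.isOpenMap _ hB''o
  obtain ⟨ε, hε, hball⟩ := Metric.isOpen_iff.mp hopen (pencilParam t) ⟨t, htB'', rfl⟩
  -- the coordinates of degree `< 2` vanish on the disc
  have hvanish : ∀ σ : Fin N, deg σ < 2 → Set.EqOn (g σ) 0 (Metric.ball (pencilParam t) ε) := by
    intro σ hσ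
    refine AnalyticOnNhd.eqOn_zero_of_preconnected_of_frequently_eq_zero
      ((hg σ).1.mono (hball.trans (Set.image_mono hB''B)))
      (convex_ball (pencilParam t) ε).isPreconnected (Metric.mem_ball_self hε) ?_
    exact hfreqC.mono fun z hz => hz.2 σ hσ
  -- hence `ξ|_{𝒳_s} ∈ F²` for all `s ∈ B''` with `ψ(s)` in the disc: a neighbourhood of `t`
  have hnhds : {s | s ∈ B'' ∧ pencilParam s ∈ Metric.ball (pencilParam t) ε} ∈ 𝓝 t :=
    Filter.inter_mem (hB''o.mem_nhds htB'')
      (continuous_pencilParam.continuousAt.preimage_mem_nhds (Metric.isOpen_ball.mem_nhds (Metric.mem_ball_self hε)))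
  refine Filter.mem_of_superset hnhds ?_
  rintro s ⟨hsB'', hsball⟩
  refine ⟨hB''B' hsB'', (hcoord s hsB'').mpr fun σ hσ => ?_⟩
  rw [(hg σ).2 ⟨s, hB''B hsB''⟩]
  exact hvanish σ hσ hsball

end Literature.AlgebraicGeometry.HodgeTheory.DworkSextic

end
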